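import Mathlib
import HarnessLib
import Summits.HubbardSuperconductivity.HubbardSuperconductivity.Theses.LiebTwin
import Summits.HubbardSuperconductivity.HubbardSuperconductivity.Theorems.LiebTwinNoOnsiteODLROEtaVacuum
import Summits.HubbardSuperconductivity.HubbardSuperconductivity.Theorems.CooperPairDMottWalkBindingWalkShibaTorus
import Literature.MathematicalPhysics.QuantumLattice.HubbardWave0LiebProofs
import Literature.MathematicalPhysics.QuantumLattice.HubbardRingPerronFrobeniusProofs
import Literature.MathematicalPhysics.QuantumLattice.HubbardSzSectorLadder
import Literature.MathematicalPhysics.QuantumLattice.HubbardLiebTwoHoppingsSector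
import Literature.MathematicalPhysics.QuantumLattice.HubbardHubbardModelEtaPairingProofs
import Literature.MathematicalPhysics.QuantumLattice.HubbardHubbardModelEtaODLROProofs

/-!
# The half-filled repulsive Hubbard torus: strict pair window and pseudospin singlet

Helper file (`--supports stmt-HubbardSuperconductivity-0933`, crux `NoOnsiteODLRO`; route-prover LiebTwin-0,
session 5), one of the inputs of the `δ = 0` endpoint of the crux (no on-site pair condensation at HALF
filling, `LiebTwinNoOnsiteODLROHalfFillingEndpoint`).

* `attractive_szSector_spinGap` — **Lieb's spin gap of the attractive torus in sector form**: for `U > 0`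
  and any even particle number `2(m+1) ≤ 2L²`, `E_{-U}(2m+2, S^z = 0) < E_{-U}(2m+2, S^z = -1)`
  (`E(N, M) = minEnergyOn (szSector N M)` of `hubbardTorus 2 L 1 (-U)`): the `N`-particle ground state is
  unique and a singlet (`lieb_attractive_holds` on the connected torus graph,
  `LiebTwoHoppings.fermionTorusGraph_connected`), and a minimiser of the coordinate sector `(m, m+2)`
  attaining the ground energy would be a second, orthogonal ground state (`ne_smul_of_isInSector_ne`).
* `halfFilling_pairWindow_pos` = registered stub **`stub_halfFillingPairWindow`**: by the Shiba dictionary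
  (`CooperPairDMottWalk.minEnergyOn_szSector_hubbardTorus_shiba`) the pair window of the REPULSIVE torus at
  half filling, `U - (E_U(L², 0) - E_U(L² - 2, 0))`, equals that attractive spin gap, hence is `> 0` for
  every even `L` (no uniformity in `L` is claimed).
* `etaLower_halfFilled_groundState_eq_zero`, `etaRaise_halfFilled_groundState_eq_zero` — every ground state of
  the half-filled sector `(L², S^z = 0)` is annihilated by Yang's `η` (the landed η-vacuum lemma
  `Pseudospin.etaLower_groundState_eq_zero_of_window` under the strict window) and by `η†`
  (`ηη† = η†η + (|Λ| - N̂)`): a pseudospin singlet (Zhang 1990).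

References: E. H. Lieb, Phys. Rev. Lett. 62 (1989) 1201, Thms 1–2 [LiebPRL1989]; H. Shiba, Prog. Theor.
Phys. 48 (1972) 2171, §2; S.-C. Zhang, Phys. Rev. Lett. 65 (1990) 120 [Zhang1990]; C. N. Yang, S.-C. Zhang,
Mod. Phys. Lett. B 4 (1990) 759 [YangZhang1990]. Everything is proved; no definition and no named fact is
introduced.
-/

-- the mandated namespace `Summit.<Summit>.<Problem>.Theorems` repeats `HubbardSuperconductivity`
set_option linter.dupNamespace false

noncomputable section

namespace Summit.HubbardSuperconductivity.HubbardSuperconductivity.Theorems.NoOnsiteODLRO.HalfFilling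

open Matrix Finset
open Literature.Probability.LatticeModels Literature.MathematicalPhysics.QuantumLattice
open scoped ComplexOrder

section AttractiveGap

variable {L : ℕ} [NeZero L]

/-- Two orthogonal coordinate sectors `(a, b) ≠ (a', b')` meet only in `0`: a nonzero vector of the
sector `(a, b)` is not a multiple-of relation away from one of the sector `(a', b')`. [folklore] -/
theorem ne_smul_of_isInSector_ne {Λ : Type*} [LinearOrder Λ] [Fintype Λ] {a b a' b' : ℕ}
    (h : ¬(a = a' ∧ b = b')) {χ φ : Fock (Orb Λ)} (hχ : IsInSector a b χ) (hφ : IsInSector a' b' φ)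
    (hχ0 : χ ≠ 0) (c : ℂ) : χ ≠ c • φ := by
  intro hc
  apply hχ0
  funext s
  by_cases hs : (upPart s).card = a ∧ (downPart s).card = b
  · have hs' : ¬((upPart s).card = a' ∧ (downPart s).card = b') := fun h' =>
      h ⟨hs.1.symm.trans h'.1, hs.2.symm.trans h'.2⟩
    rw [hc, Pi.smul_apply, hφ s hs', smul_zero, Pi.zero_apply]
  · exact hχ s hs

/-- **Lieb's spin gap of the attractive Hubbard torus at even filling, sector form.** For `U > 0`,
`L` even and `2(m+1) ≤ 2L²` (any even particle number), the lowest energy of the ATTRACTIVE torus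
`hubbardTorus 2 L 1 (-U)` in the joint sector `(2m+2, S^z = -1)` is STRICTLY above the one in
`(2m+2, S^z = 0)`: the `2(m+1)`-particle ground state is unique and a singlet (Lieb's Theorem 1,
`lieb_attractive_holds`, on the connected torus graph), so no `S^z = -1` vector attains the ground energy
(a minimiser of the `(m, m+2)` sector would be an `N`-particle ground state orthogonal to the singlet).
Lieb, PRL 62 (1989) 1201, Theorem 1. [cite: LiebPRL1989, Theorem 1] -/
theorem attractive_szSector_spinGap {U : ℝ} (hU : 0 < U) {m : ℕ} (hm : m + 2 ≤ L ^ 2) :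
    (hubbardTorus 2 L 1 (-U)).minEnergyOn (szSector (2 * (m + 1)) 0) <
      (hubbardTorus 2 L 1 (-U)).minEnergyOn (szSector (m + (m + 2)) ((((m : ℕ) : ℝ) - ((m + 2 : ℕ) : ℝ)) / 2)) := by
  have hcard : Fintype.card (FermionTorus 2 L) = L ^ 2 := card_fermionTorus 2 L
  set G := fermionTorusGraph 2 L with hG
  have hH : hubbardTorus 2 L 1 (-U) = hamiltonian G 1 (-U) := rfl
  rw [hH]
  set H := hamiltonian G 1 (-U) with hHdef
  have hm1 : m + 1 ≤ Fintype.card (FermionTorus 2 L) := by omega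
  have hm0 : m ≤ Fintype.card (FermionTorus 2 L) := by omega
  have hm2 : m + 2 ≤ Fintype.card (FermionTorus 2 L) := by omega
  -- the `S^z = 0` minimiser and the `S^z = -1` minimiser
  obtain ⟨⟨φ₁, hφ₁mem, hφ₁0, hHφ₁⟩, -⟩ := szSector_groundState G 1 (-U) hm1
  obtain ⟨⟨χ, hχsec, hχ0, hHχ⟩, -⟩ := upDownSector_groundState G 1 (-U) hm0 hm2
  set E₀ : ℝ := H.minEnergyOn (szSector (2 * (m + 1)) 0) with hE₀
  set E₁ : ℝ := H.minEnergyOn (szSector (m + (m + 2)) ((((m : ℕ) : ℝ) - ((m + 2 : ℕ) : ℝ)) / 2)) with hE₁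
  -- ground energies of the `N`-particle sector
  have hN : m + (m + 2) = 2 * (m + 1) := by ring
  have hGE : groundEnergy H (2 * (m + 1)) = E₀ := groundEnergyAt_eq_minEnergyOn_szSector G 1 (-U) hm1
  have hχN : IsNParticle (2 * (m + 1)) χ := hN ▸ hχsec.isNParticle
  have hle : groundEnergy H (2 * (m + 1)) ≤ E₁ := by
    have h := LiebThm1.groundEnergy_mul_norm_le H hχN
    change _ ≤ (star χ ⬝ᵥ (H *ᵥ χ)).re at h
    rw [hHχ, dotProduct_smul, smul_eq_mul, Complex.re_ofReal_mul] at h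
    have hpos : 0 < (star χ ⬝ᵥ χ).re := by
      have h1 : 0 < star χ ⬝ᵥ χ := lt_of_le_of_ne (dotProduct_star_self_nonneg χ)
        (Ne.symm (mt dotProduct_star_self_eq_zero.1 hχ0))
      exact (Complex.pos_iff.1 h1).1
    exact le_of_mul_le_mul_right h hpos
  by_contra hge
  push Not at hge
  -- then `E₁` is the ground energy, and `χ` a ground state orthogonal to the singlet line
  have hE₁eq : E₁ = groundEnergy H (2 * (m + 1)) := le_antisymm (hGE ▸ hge) hle
  have hconn : G.Connected := LiebTwoHoppings.fermionTorusGraph_connected 2 L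
  have hLieb := (lieb_attractive_holds G hconn 1 (-U) one_ne_zero (by linarith) (2 * (m + 1))
    (even_two_mul _) (by omega)).1
  have hφ₁N : IsNParticle (2 * (m + 1)) φ₁ := ((mem_szSector_iff _ _ _).1 hφ₁mem).1
  have hφ₁gs : IsGroundState H (2 * (m + 1)) φ₁ := ⟨hφ₁N, hφ₁0, by rw [hHφ₁, hGE]⟩
  have hχgs : IsGroundState H (2 * (m + 1)) χ := ⟨hχN, hχ0, by rw [hHχ, hE₁eq]⟩
  obtain ⟨c, hc⟩ := hLieb φ₁ χ hφ₁gs hχgs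
  have hφ₁sec : IsInSector (m + 1) (m + 1) φ₁ := (mem_szSector_two_mul_zero_iff (m + 1) φ₁).1 hφ₁mem
  exact ne_smul_of_isInSector_ne (by omega) hχsec hφ₁sec hχ0 c hc

end AttractiveGap

section HalfFilling

variable {L : ℕ} [NeZero L]

/-- **The pair window of the half-filled repulsive torus is strict.** For `U > 0`, `L` even and
`2(m+1) = L²`: `0 < U - (E(L², 0) - E(L² - 2, 0))`, `E(N, 0) = minEnergyOn (hubbardTorus 2 L 1 U)
(szSector N 0)`. By the Shiba dictionary (`minEnergyOn_szSector_hubbardTorus_shiba`) the window equals the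
attractive spin gap `E_{-U}(L², S^z = -1) - E_{-U}(L², 0)`, positive by `attractive_szSector_spinGap`.
Lieb, PRL 62 (1989) 1201, Thms 1–2; Shiba, Prog. Theor. Phys. 48 (1972) 2171. [folklore] -/
theorem halfFilling_pairWindow_pos (hL : Even L) {U : ℝ} (hU : 0 < U) {m : ℕ} (hm : 2 * (m + 1) = L ^ 2) :
    0 < U - ((hubbardTorus 2 L 1 U).minEnergyOn (szSector (2 * (m + 1)) 0) -
      (hubbardTorus 2 L 1 U).minEnergyOn (szSector (2 * (m + 1) - 2) 0)) := by
  have hgap := attractive_szSector_spinGap (L := L) hU (m := m) (by omega)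
  -- dictionary at `(m+1, m+1)` and at `(m, m)`
  have h1 := CooperPairDMottWalk.minEnergyOn_szSector_hubbardTorus_shiba (d := 2) hL 1 U (a := m + 1) (b := m + 1)
    (by omega) (by omega)
  have h0 := CooperPairDMottWalk.minEnergyOn_szSector_hubbardTorus_shiba (d := 2) hL 1 U (a := m) (b := m) (by omega) (by omega)
  have hs1 : L ^ 2 - (m + 1) = m + 1 := by omega
  have hs0 : L ^ 2 - m = m + 2 := by omega
  rw [hs1] at h1
  rw [hs0] at h0
  have e1 : szSector (Λ := FermionTorus 2 L) (m + 1 + (m + 1)) ((((m + 1 : ℕ) : ℝ) - ((m + 1 : ℕ) : ℝ)) / 2) =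
      szSector (2 * (m + 1)) 0 := by
    congr 1 <;> [ring; simp]
  have e0 : szSector (Λ := FermionTorus 2 L) (m + m) ((((m : ℕ) : ℝ) - ((m : ℕ) : ℝ)) / 2) =
      szSector (2 * (m + 1) - 2) 0 := by
    congr 1 <;> [omega; simp]
  rw [e1] at h1
  rw [e0] at h0
  rw [h1, h0]
  have hc : U * ((m + 1 : ℕ) : ℝ) = U * (m : ℝ) + U := by push_cast; ring
  linarith [hgap, hc]

/-- **The half-filled ground state is an `η`-vacuum.** For `U > 0`, `L` even, `2(m+1) = L²` and every
ground state `ψ` of `hubbardTorus 2 L 1 U` in the joint sector `(L², S^z = 0)`: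
`etaLower torusStagger ψ = 0` (the strict pair window plus `etaLower_groundState_eq_zero_of_window`).
Equivalently `ψ` is a lowest-weight vector of Yang's pseudospin `SU(2)`; with `η^z ψ = 0` at half filling
it is a pseudospin SINGLET (`etaRaise_halfFilled_groundState_eq_zero`). Zhang, PRL 65 (1990) 120;
Yang–Zhang, Mod. Phys. Lett. B 4 (1990) 759; Lieb, PRL 62 (1989) 1201. [folklore] -/
theorem etaLower_halfFilled_groundState_eq_zero (hL : Even L) {U : ℝ} (hU : 0 < U) {m : ℕ}
    (hm : 2 * (m + 1) = L ^ 2) {ψ : Fock (Orb (FermionTorus 2 L))}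
    (hψ : IsGroundStateInSector (hubbardTorus 2 L 1 U) (2 * (m + 1)) 0 ψ) :
    etaLower torusStagger *ᵥ ψ = 0 :=
  Pseudospin.etaLower_groundState_eq_zero_of_window hL U (by omega) hψ (halfFilling_pairWindow_pos hL hU hm)

/-- At half filling the `η`-vacuum is also annihilated by `η†`: `etaRaise torusStagger ψ = 0` for every
ground state `ψ` of the sector `(L², 0)` (`η η† ψ = η† η ψ + (|Λ| - N̂) ψ = 0`, hence `‖η†ψ‖ = 0`).
Yang–Zhang, Mod. Phys. Lett. B 4 (1990) 759, Thm 1; Zhang, PRL 65 (1990) 120. [folklore] -/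
theorem etaRaise_halfFilled_groundState_eq_zero (hL : Even L) {U : ℝ} (hU : 0 < U) {m : ℕ}
    (hm : 2 * (m + 1) = L ^ 2) {ψ : Fock (Orb (FermionTorus 2 L))}
    (hψ : IsGroundStateInSector (hubbardTorus 2 L 1 U) (2 * (m + 1)) 0 ψ) :
    etaRaise torusStagger *ᵥ ψ = 0 := by
  have hη := etaLower_halfFilled_groundState_eq_zero hL hU hm hψ
  have hN : IsNParticle (2 * (m + 1)) ψ := ((mem_szSector_iff _ _ _).1 hψ.1).1
  have hcard : Fintype.card (FermionTorus 2 L) = L ^ 2 := card_fermionTorus 2 L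
  -- `η (η† ψ) = 0`
  have hηη : etaLower torusStagger *ᵥ (etaRaise torusStagger *ᵥ ψ) = 0 := by
    rw [EtaPairingODLRO.etaLower_mulVec_etaRaise_mulVec, hη, mulVec_zero, zero_add]
    funext s
    by_cases hs : s.card = 2 * (m + 1)
    · rw [hs, hcard, ← hm, sub_self, zero_mul, Pi.zero_apply]
    · rw [hN s hs, mul_zero, Pi.zero_apply]
  -- `‖η† ψ‖² = ⟨ψ, η η† ψ⟩ = 0`
  have h0 : star (etaRaise torusStagger *ᵥ ψ) ⬝ᵥ (etaRaise torusStagger *ᵥ ψ) = 0 := by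
    rw [EnslavedA1g.star_dotProduct_mulVec_eq_conjTranspose]
    change star (etaLower torusStagger *ᵥ (etaRaise torusStagger *ᵥ ψ)) ⬝ᵥ ψ = 0
    rw [hηη, star_zero, zero_dotProduct]
  exact dotProduct_star_self_eq_zero.1 h0

end HalfFilling


section Stub

/-- **Registered stub `stub_halfFillingPairWindow`** of crux `NoOnsiteODLRO` (stmt-HubbardSuperconductivity-0933;
by-product — input of the `δ = 0` endpoint, not a piece of a line composition): the pair window of the
half-filled repulsive Hubbard torus is strict, `0 < U - (E(L², 0) - E(L² - 2, 0))` for `U > 0`, `L` even,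
`2(m+1) = L²` (`halfFilling_pairWindow_pos`). With the landed pseudospin ceiling
(`Pseudospin.pseudospinOnsiteCeiling`) this already gives `Re⟨ψ, P_sᴴP_sψ⟩ ≤ 8L²‖ψ‖²/w_L` for the window
`w_L > 0`; the uniform rate `O(L²/√U)` is the endpoint file. Lieb, PRL 62 (1989) 1201; Zhang, PRL 65
(1990) 120. [cite: LiebPRL1989, Theorem 1] -/
theorem stub_halfFillingPairWindow : open Literature.MathematicalPhysics.QuantumLattice in ∀ (U : ℝ), 0 < U → ∀ (L : ℕ) [NeZero L], Even L → ∀ (m : ℕ), 2 * (m + 1) = L ^ 2 → 0 < U - ((hubbardTorus 2 L 1 U).minEnergyOn (szSector (2 * (m + 1)) 0) - (hubbardTorus 2 L 1 U).minEnergyOn (szSector (2 * (m + 1) - 2) 0)) :=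
  fun _U hU _L _ hL _m hm => halfFilling_pairWindow_pos hL hU hm

end Stub

end Summit.HubbardSuperconductivity.HubbardSuperconductivity.Theorems.NoOnsiteODLRO.HalfFilling
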